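import Summits.BirchSwinnertonDyer.BirchSwinnertonDyer.Theorems.EisensteinPrimesMazurMCOnCellBTwistbackKLFlatPartner
import Summits.BirchSwinnertonDyer.BirchSwinnertonDyer.Theorems.EisensteinPrimesMazurMCOnCellBTwistbackTwistLineCharactersPackage
import Summits.BirchSwinnertonDyer.BirchSwinnertonDyer.Theorems.EisensteinPrimesMazurMCOnCellBTwistbackTwistLocalBalance
import Summits.BirchSwinnertonDyer.BirchSwinnertonDyer.Theorems.GenusKolyvaginAtTwoGenusPrimitiveSupplyAtTwoHeegnerTwinTamagawaOdd
import Literature.NumberTheory.EllipticCurves.ShafarevichGoodReductionBadPlacesProofs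
import Literature.NumberTheory.EllipticCurves.HeegnerHypothesisKroneckerProofs
import Literature.NumberTheory.EllipticCurves.HeegnerPointsImaginaryQuadraticProofs
import Literature.NumberTheory.EllipticCurves.TateCurve.NumberFieldUniformization
import Literature.NumberTheory.EllipticCurves.TateCurve.NumberFieldUniformizationTwisted
import Literature.NumberTheory.EllipticCurves.IsogenyIdProofs
import Literature.NumberTheory.EllipticCurves.LFunctionPrimeCoeff
import Literature.NumberTheory.QuadraticFields.FundamentalDiscriminant
import Literature.NumberTheory.QuadraticFields.JacobiCharacter
import HarnessLib

/-!
# Crux 3 `MazurMCOnCellB` (stmt-BirchSwinnertonDyer-19033), line `twistback` v4 — the TWIST DOOR FROM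
# THE `W`-SIDE: the KL-flat carrier clause `hKL` of `…TwistbackKLFlatPartner` §3 AT THE TWIST `E^{(d_K)}`,
# from the line datum of `E`, the field `K`, two units and the local balance of `E` — nothing else

Width seat bsd-line-x2-p1-w3 (gen 9), cell `bsd-eis` (run/shared/lean/pub/bsd-eis/), 2026-08-28. HONEST FRAMING:
assembly of the twist-character dictionary (w3 gen 8: p648132 / p648554 / p649377 / p650230) with the `S₀`-clauses of
the twist, the isogeny invariance of `δ` and of good reduction, and the indicator transfer at `ℓ = 2`; THEOREMS ONLY
(no `def`, no named fact introduced, no `sorry`); `--supports` stmt-BirchSwinnertonDyer-19033; closes no stub by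
itself; no summit statement, no Mazur main conjecture and no BSD is proved for any curve; 0 cells / labels / tiers move.

WHY (LEAD bsd-line-x2-p1 g10 verdict §4(2), `Cruxes/MazurMCOnCellB/Lines/twistback-lead-verdict-g10.md`: «write the
twist-character dictionary so that c(E^K) = c(E) and KL-flat ⟺ 3 ∤ h(D d_K) are kernel statements about E and K only»).
The door `upperPartner_at_of_klFlat_partner` (p645525 §3) asks, for EVERY globally minimal model `Wd` of the twist
`W^{(d_K)}`, for a carrier `V′ ~ Wd` with a RAMIFIED-EVEN rational line, PRIMITIVE characters, the `S₀`-clauses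
(`p ∉ S₀′`, `V′` good off `S₀′ ∪ {p}`), two KL-flat units and the local balance — fourteen conjuncts about the TWIST.
This file produces all fourteen from data on `W` and `K`:

* §1 transport lemmas: `delta_eq_of_isIsogenous` (`δ` is an isogeny invariant: `L_v` is, tree
  `Isogeny.localPolynomialAt_eq_of_isElliptic`); `hasGoodReductionAt_of_smul_eq_quadraticTwist` (a model of `W^{(D)}`,
  `D ≡ 1 (mod 4)`, is good at every place `v ∤ D` where `W` is good — ALSO `v ∣ 2`, tree
  `GenusKolyTwin.hasGoodReductionAtPrime_twist_of_not_dvd` + the place/prime bridge); `chi_natCast_eq_one_of_heegner'`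
  (`χ_{d_K}(ℓ) = 1` at EVERY prime `ℓ ∣ N` under Heegner, `ℓ = 2` included: `2` split ⟺ `d_K ≡ 1 (mod 8)` ⟺
  `(2/|d_K|) = 1`); `exists_finset_forall_mem_iff_natGenerator_dvd` / `exists_places_discr` (the finite set `T` of
  places of `d_K`: disjoint from `S₀`, missing `(p)`); `discr_emod_four_eq_one_and_squarefree_natAbs_of_odd`;
  `mulChar_eq_of_forall_natCast` (the Jacobi character is determined by its values on `ℕ`).
* §2 `klFlatCarrier_twist_of_lineRamifiedOdd` — FIRST X2b SHAPE (line of `W` RAMIFIED-ODD): for `Wd` a globally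
  minimal model of `W^{(d_K)}` the carrier clause holds with `V′ = Wd`, `S₀′ = S₀ ∪ T`, characters `(φχ̄, ψχ̄)`.
* the SECOND X2b SHAPE (line of `W` UNRAMIFIED-EVEN; carrier `V′ = Wd/Ψ₀`) and the composition with the door
  `upperPartner_at_of_klFlat_partner` are in the sequel `…TwistbackTwistDoorIsogenous`.

Inputs of §2, all about `W` and `K`: `p` odd; `K` imaginary quadratic with `d_K` odd, Heegner for a level `N₀` and
for `p`; the Jacobi character `χ` mod `|d_K|` (ANY `ℤ`-valued character with `χ(a) = (a/|d_K|)`; it exists by part 3);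
a rational line `Φ₀ ≤ W[p]` with primitive characters `φ` (mod `m`), `ψ` (mod `d`), `gcd(m d, d_K) = 1`; a finite set
`S₀ ∌ (p)` of places with `ℓ_v ∣ N₀` on `S₀` and `W` good off `S₀ ∪ {p}`; the two units
`‖L_∅(C,0)‖ = ‖L_∅(D,0)‖ = 1` of the EXPLICIT twisted characters; the balance `n + Σ_{S₀} δ_W = Σ_{S₀} s([φ=ℓ̄]+[ψ=ℓ̄])`.
NOT here: the existence of admissible `K` (Kriz–Li; width seat w6), `r_an(E^{(d_K)}) = 1` (w5: KY Thm. E), the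
class-number reading of the two units (w3 g6/g7, LEAD p645771).

References: [GreenbergVatsal2000] Thm. (1.3), §2 Prop. (2.4) p. 22 and p. 28, §3 (28) p. 42; [SilvermanAEC2009] VII.5
Prop. 5.1, Cor. VII.7.2, X.5 Cor. 5.4; [SilvermanATAEC1994] IV.9.4, Thm. V.5.3, Cor. V.5.4; [Cox2013] §1.C Lemma 1.14;
[IrelandRosen1990] Prop. 13.1.4, Ch. 20 §5; [Knapp1993] Thm. 11.67.
-/

set_option autoImplicit false

-- `Summit.BirchSwinnertonDyer.BirchSwinnertonDyer.…`: the summit and its single sub-problem share a name.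
set_option linter.dupNamespace false

noncomputable section

open scoped Classical NumberTheorySymbols

open WeierstrassCurve NumberField IsDedekindDomain Field DirichletCharacter
  Literature.NumberTheory.EllipticCurves Literature.NumberTheory.GaloisRepresentations
  Literature.NumberTheory.EllipticCurves.GreenbergVatsal2000
  Literature.NumberTheory.EllipticCurves.Rank1Residual
  Literature.NumberTheory.QuadraticFields Literature.NumberTheory.QuadraticFields.Quadratic
  Summit.BirchSwinnertonDyer.Rank1Residual Summit.BirchSwinnertonDyer.Rank1Residual.X2
  Summit.BirchSwinnertonDyer.BirchSwinnertonDyer.Theorems.EisensteinPrimesMazurMCOnCellBTwistbackTwistLineCharacters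
  Summit.BirchSwinnertonDyer.BirchSwinnertonDyer.Theorems.EisensteinPrimesMazurMCOnCellBTwistbackTwistLineCharactersPackage
  Summit.BirchSwinnertonDyer.BirchSwinnertonDyer.Theorems.EisensteinPrimesMazurMCOnCellBTwistbackQuadraticRadical
  Summit.BirchSwinnertonDyer.BirchSwinnertonDyer.Theorems.EisensteinPrimesMazurMCOnCellBTwistbackTwistLocalBalance

namespace Summit.BirchSwinnertonDyer.BirchSwinnertonDyer.Theorems.EisensteinPrimesMazurMCOnCellBTwistbackTwistDoor

/-! ## §1. Transport lemmas -/

/-- **`δ` is an isogeny invariant**: `δ_{V′}^{(v)} = δ_V^{(v)}` for `ℚ`-isogenous elliptic curves (`δ = s_ℓ·mult_{ℓ̄⁻¹}(L_v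
mod p)` and `L_v(V′) = L_v(V)`, tree `Isogeny.localPolynomialAt_eq_of_isElliptic`).
[cite: GreenbergVatsal2000, §2 Prop. (2.4) (p. 22)] [cite: Knapp1993, Thm. 11.67] -/
theorem delta_eq_of_isIsogenous {V V' : WeierstrassCurve ℚ} [V.IsElliptic] [V'.IsElliptic]
    (h : IsIsogenous V V') (p : ℕ) (v : HeightOneSpectrum (𝓞 ℚ)) : delta V' p v = delta V p v :=
  h.elim fun f ↦ delta_eq_of_localPolynomialAt_eq p (f.localPolynomialAt_eq_of_isElliptic v).symm

/-- **A model of the twist `W^{(D)}`, `D ≡ 1 (mod 4)`, has good reduction at every place `v ∤ D` where `W` is good**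
(also `v ∣ 2`: the twist is unramified there) — the tree's prime-indexed
`GenusKolyTwin.hasGoodReductionAtPrime_twist_of_not_dvd` (conductor exponents agree off `D`) moved to the place `v`
by `hasGoodReductionAtPrime_primesEquiv_iff_holds`. [cite: SilvermanATAEC1994, IV.9.4] [cite: SilvermanAEC2009, VII.5 Prop. 5.1(a)] -/
theorem hasGoodReductionAt_of_smul_eq_quadraticTwist {W Wd : WeierstrassCurve ℚ} [W.IsElliptic] [Wd.IsElliptic]
    {D : ℤ} (hD4 : D % 4 = 1) (C : VariableChange ℚ) (hC : C • Wd = W.quadraticTwist ((D : ℤ) : ℚ))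
    (v : HeightOneSpectrum (𝓞 ℚ)) (hvD : ¬ ((Rat.HeightOneSpectrum.natGenerator v : ℕ) : ℤ) ∣ D)
    (hgood : W.HasGoodReductionAt v) : Wd.HasGoodReductionAt v := by
  haveI : Fact (Rat.HeightOneSpectrum.natGenerator v).Prime := ⟨Rat.HeightOneSpectrum.prime_natGenerator v⟩
  have hb : ∀ (X : WeierstrassCurve ℚ),
      X.HasGoodReductionAtPrime (Rat.HeightOneSpectrum.natGenerator v) ↔ X.HasGoodReductionAt v :=
    fun X ↦ hasGoodReductionAtPrime_primesEquiv_iff_holds X v _ rfl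
  have hC' : C⁻¹ • W.quadraticTwist ((D : ℤ) : ℚ) = Wd := by rw [← hC, inv_smul_smul]
  exact (hb Wd).mp (GenusKolyTwin.hasGoodReductionAtPrime_twist_of_not_dvd W hD4 C⁻¹ hC' _
    ((hb W).mpr hgood) hvD)

/-- **`χ_{d_K}(ℓ) = 1` at EVERY prime `ℓ ∣ N₀` under the Heegner hypothesis**, `ℓ = 2` included (`2` splits in `K` iff
`d_K ≡ 1 (mod 8)` iff `(2/|d_K|) = 1`; odd `ℓ`: part 4's `chi_natCast_eq_one_of_heegner`), for any `ℤ`-valued `χ`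
modulo `|d_K|` with `χ(a) = (a/|d_K|)`, `d_K ≡ 1 (mod 4)`. [cite: Cox2013, §1.C Lemma 1.14 and (1.17)]
[cite: IrelandRosen1990, Prop. 13.1.4] [cite: GrossZagier1986, §I.1 (the Heegner hypothesis)] -/
theorem chi_natCast_eq_one_of_heegner' {K : Type} [Field K] [NumberField K] (h2 : Module.finrank ℚ K = 2)
    (hD : NumberField.discr K % 4 = 1) {N₀ : ℕ} (hH : SatisfiesHeegnerHypothesis N₀ K)
    (χ : MulChar (ZMod (NumberField.discr K).natAbs) ℤ)
    (hχ : ∀ a : ℕ, χ (a : ZMod (NumberField.discr K).natAbs) = J((a : ℤ) | (NumberField.discr K).natAbs))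
    {ℓ : ℕ} (hℓ : ℓ.Prime) (hℓN : ℓ ∣ N₀) :
    χ (ℓ : ZMod (NumberField.discr K).natAbs) = 1 := by
  by_cases hℓ2 : ℓ = 2
  · subst hℓ2
    rw [hχ, Nat.cast_ofNat]
    exact (jacobiSym_two_natAbs_eq_one_iff hD).mpr ((ncard_primesOver_two_eq_two_iff h2).mp (hH 2 hℓ hℓN))
  · exact chi_natCast_eq_one_of_heegner h2 hD hH χ hχ hℓ hℓ2 hℓN

/-- **The places of a non-zero natural number**: a finite set `T` of finite places of `ℚ` with `v ∈ T ↔ ℓ_v ∣ n`.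
[folklore] -/
theorem exists_finset_forall_mem_iff_natGenerator_dvd (n : ℕ) (hn : n ≠ 0) :
    ∃ T : Finset (HeightOneSpectrum (𝓞 ℚ)), ∀ v, v ∈ T ↔ Rat.HeightOneSpectrum.natGenerator v ∣ n := by
  refine ⟨(n.primeFactors.subtype Nat.Prime).image
    fun q ↦ (Rat.HeightOneSpectrum.primesEquiv (R := 𝓞 ℚ)).symm q, fun v ↦ ?_⟩
  simp only [Finset.mem_image, Equiv.symm_apply_eq]
  constructor
  · rintro ⟨q, hq, hqv⟩
    have h : (q : ℕ) = Rat.HeightOneSpectrum.natGenerator v := congrArg Subtype.val hqv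
    rw [← h]
    exact Nat.dvd_of_mem_primeFactors (Finset.mem_subtype.mp hq)
  · intro hv
    exact ⟨⟨Rat.HeightOneSpectrum.natGenerator v, Rat.HeightOneSpectrum.prime_natGenerator v⟩,
      Finset.mem_subtype.mpr
        (Nat.mem_primeFactors.mpr ⟨Rat.HeightOneSpectrum.prime_natGenerator v, hv, hn⟩), rfl⟩

/-- **The places of `d_K` on the twistback road (bookkeeping).** For `K` quadratic, Heegner for `N₀`, a prime `p ∤ d_K`
and a finite set of places `S₀` with `ℓ_v ∣ N₀` on `S₀`: the finite set `T` of places dividing `d_K` is disjoint from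
`S₀` (the primes of `N₀` split, those of `d_K` ramify), misses `(p)`, and at `v ∈ T` the prime `ℓ_v` is not coprime
to `|d_K|` and is non-zero modulo `p`. [cite: GrossZagier1986, §I.1 (the Heegner hypothesis, (N, d_K) = 1)] -/
theorem exists_places_discr {K : Type} [Field K] [NumberField K] (h2 : Module.finrank ℚ K = 2)
    [NeZero (NumberField.discr K).natAbs] {p : ℕ} (hp : p.Prime) (hpD : ¬ (p : ℤ) ∣ NumberField.discr K)
    {N₀ : ℕ} (hHN : SatisfiesHeegnerHypothesis N₀ K) (S₀ : Finset (HeightOneSpectrum (𝓞 ℚ)))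
    (hS₀N : ∀ v ∈ S₀, Rat.HeightOneSpectrum.natGenerator v ∣ N₀) :
    ∃ T : Finset (HeightOneSpectrum (𝓞 ℚ)),
      (∀ v, v ∈ T ↔ Rat.HeightOneSpectrum.natGenerator v ∣ (NumberField.discr K).natAbs) ∧ Disjoint S₀ T ∧
      (∀ v ∈ T, ((Rat.HeightOneSpectrum.natGenerator v : ℕ) : ℤ) ∣ NumberField.discr K) ∧
      (∀ v ∈ T, ((p : ℕ) : 𝓞 ℚ) ∉ v.asIdeal) ∧ (∀ v ∈ T, v ∉ S₀) ∧
      (∀ v ∈ T, ¬ (Rat.HeightOneSpectrum.natGenerator v).Coprime (NumberField.discr K).natAbs) ∧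
      (∀ v ∈ T, (Rat.HeightOneSpectrum.natGenerator v : ZMod p) ≠ 0) := by
  obtain ⟨T, hT⟩ :=
    exists_finset_forall_mem_iff_natGenerator_dvd (NumberField.discr K).natAbs (NeZero.ne _)
  have hgen : ∀ v : HeightOneSpectrum (𝓞 ℚ),
      ((p : ℕ) : 𝓞 ℚ) ∈ v.asIdeal ↔ Rat.HeightOneSpectrum.natGenerator v = p := fun v ↦
    (Rat.natCast_mem_asIdeal_iff v).trans
      (Nat.prime_dvd_prime_iff_eq (Rat.HeightOneSpectrum.prime_natGenerator v) hp)
  have hTD : ∀ v ∈ T, ((Rat.HeightOneSpectrum.natGenerator v : ℕ) : ℤ) ∣ NumberField.discr K :=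
    fun v hv ↦ Int.natCast_dvd.mpr ((hT v).mp hv)
  have hTp : ∀ v ∈ T, ((p : ℕ) : 𝓞 ℚ) ∉ v.asIdeal := by
    intro v hv h
    have h' := hTD v hv
    rw [(hgen v).mp h] at h'
    exact hpD h'
  have hTS : ∀ v ∈ T, v ∉ S₀ := fun v hv hvS ↦
    Literature.SatisfiesHeegnerHypothesis.not_dvd_discr h2 hHN (Rat.HeightOneSpectrum.prime_natGenerator v)
      (hS₀N v hvS) (hTD v hv)
  refine ⟨T, hT, Finset.disjoint_right.mpr hTS, hTD, hTp, hTS, fun v hv h ↦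
    (Nat.Prime.coprime_iff_not_dvd (Rat.HeightOneSpectrum.prime_natGenerator v)).mp h ((hT v).mp hv),
    fun v hv h ↦ ?_⟩
  rw [ZMod.natCast_eq_zero_iff] at h
  exact hTp v hv ((hgen v).mpr
    ((Nat.prime_dvd_prime_iff_eq hp (Rat.HeightOneSpectrum.prime_natGenerator v)).mp h).symm)

/-- **`d_K` odd ⟹ `d_K ≡ 1 (mod 4)` and `|d_K|` squarefree** (a quadratic discriminant is fundamental; oddness
excludes `4 ∣ d_K`). [folklore] -/
theorem discr_emod_four_eq_one_and_squarefree_natAbs_of_odd {K : Type} [Field K] [NumberField K]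
    (h2 : Module.finrank ℚ K = 2) (hodd : Odd (NumberField.discr K)) :
    NumberField.discr K % 4 = 1 ∧ Squarefree (NumberField.discr K).natAbs := by
  rcases isFundamentalDiscriminant_discr (K := K) h2 with ⟨h1, hsq, -⟩ | ⟨h4, -, -⟩
  · exact ⟨h1, Int.squarefree_natAbs.mpr hsq⟩
  · exfalso
    obtain ⟨k, hk⟩ := hodd
    obtain ⟨j, hj⟩ := h4
    omega

/-- **A `ℤ`-valued character modulo `n ≠ 0` is determined by its values on `ℕ`** (every residue is a natural
number). [folklore] -/
theorem mulChar_eq_of_forall_natCast {n : ℕ} [NeZero n] {χ χ' : MulChar (ZMod n) ℤ}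
    (h : ∀ a : ℕ, χ (a : ZMod n) = χ' (a : ZMod n)) : χ = χ' := by
  refine MulChar.ext fun u ↦ ?_
  rw [← ZMod.natCast_zmod_val (u : ZMod n), h]

/-! ## §2. First X2b shape: the line of `W` RAMIFIED-ODD — the carrier is the twist itself -/

/-- **The KL-flat carrier clause of the door AT THE TWIST, FIRST X2b SHAPE (the line of `W` is RAMIFIED at `p` and
ODD).** Data, all about `W` and `K`: `p` odd; `K` imaginary quadratic with `d_K` odd, Heegner for a level `N₀` and for
`p`; `χ` the Jacobi character modulo `|d_K|` (`χ(a) = (a/|d_K|)`); a rational line `Φ₀ ≤ W[p]`, ramified-odd, with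
PRIMITIVE characters `φ` (mod `m`, `p ∣ m`) and `ψ` (mod `d`, `p ∤ d`), `gcd(m, d_K) = gcd(d, d_K) = 1`; a finite set
of places `S₀ ∌ (p)` with `ℓ_v ∣ N₀` on `S₀` and `W` good off `S₀ ∪ {p}`; the two units `‖L_∅(C,0)‖ = ‖L_∅(D,0)‖ = 1`
of the twisted characters `φχ̄` (mod `m|d_K|`), `ψχ̄` (mod `d|d_K|`); the balance `n + Σ_{S₀} δ_W^{(v)} =
Σ_{S₀} s_v([φ(ℓ_v) = ℓ̄_v] + [ψ(ℓ_v) = ℓ̄_v])`. Conclusion: EVERY globally minimal model `Wd` of `W^{(d_K)}` satisfies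
the carrier clause of `…TwistbackKLFlatPartner` §3 `hKL` (with `n` for `1`): `V′ = Wd`, `S₀′ = S₀ ∪ {v : ℓ_v ∣ d_K}`,
line `e⁻¹Φ₀` ramified-even (part 2), characters `(φχ̄, ψχ̄)` primitive (part 1), `p ∉ S₀′` (`p` splits, the primes of
`d_K` ramify), `Wd` good off `S₀′ ∪ {p}` (§1), balance over `S₀′` (part 4's `balance_union_iff`: `δ_{Wd} = δ_W` and
`χ(ℓ_v) = 1` on `S₀` — Heegner, `ℓ = 2` included —, `δ_{Wd} = 0` and `(φχ̄)(ℓ_v) = (ψχ̄)(ℓ_v) = 0` on the primes of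
`d_K`, where `W` is good since they do not divide `N₀`). No main conjecture / BSD is proved here.
[cite: GreenbergVatsal2000, Thm. (1.3), §2 Prop. (2.4) p. 22, §3 (28) p. 42] [cite: SilvermanAEC2009, X.5 Cor. 5.4, VII.5 Prop. 5.1]
[cite: SilvermanATAEC1994, IV.9.4] [cite: Cox2013, §1.C Lemma 1.14] [cite: IrelandRosen1990, Ch. 20 §5 Prop. 20.5.4] -/
theorem klFlatCarrier_twist_of_lineRamifiedOdd
    (W : WeierstrassCurve ℚ) [W.IsElliptic] {p : ℕ} [Fact p.Prime] (hp2 : p ≠ 2)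
    (K : Type) [Field K] [NumberField K] (hK : IsImaginaryQuadratic K) (hodd : Odd (NumberField.discr K))
    [NeZero (NumberField.discr K).natAbs]
    {N₀ : ℕ} (hHN : SatisfiesHeegnerHypothesis N₀ K) (hHp : SatisfiesHeegnerHypothesis p K)
    (χ : MulChar (ZMod (NumberField.discr K).natAbs) ℤ)
    (hχJ : ∀ a : ℕ, χ (a : ZMod (NumberField.discr K).natAbs) = J((a : ℤ) | (NumberField.discr K).natAbs))
    {Φ₀ : AddSubgroup (geomTorsion W (p : ℤ))} (hΦ : IsRationalLine W p Φ₀)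
    (hram : ¬ LineUnramifiedAt W p Φ₀) (hoddL : LineOdd W p Φ₀)
    {m : ℕ} [NeZero m] (φ : DirichletCharacter (ZMod p) m) {d : ℕ} [NeZero d]
    (ψ : DirichletCharacter (ZMod p) d) (hφ : φ.IsPrimitive) (hψ : ψ.IsPrimitive) (hpm : p ∣ m)
    (hpd : ¬ p ∣ d) (hmD : m.Coprime (NumberField.discr K).natAbs)
    (hdD : d.Coprime (NumberField.discr K).natAbs)
    (hφ0 : ∀ (σ : absoluteGaloisGroup ℚ), ∀ P ∈ Φ₀,
      σ • P = (φ ((modNCyclotomicCharacter ℚ m σ : (ZMod m)ˣ) : ZMod m)).val • P)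
    (hψ0 : ∀ (σ : absoluteGaloisGroup ℚ) (P : geomTorsion W (p : ℤ)),
      σ • P - (ψ ((modNCyclotomicCharacter ℚ d σ : (ZMod d)ˣ) : ZMod d)).val • P ∈ Φ₀)
    (S₀ : Finset (HeightOneSpectrum (𝓞 ℚ))) (hS₀p : ∀ v ∈ S₀, ((p : ℕ) : 𝓞 ℚ) ∉ v.asIdeal)
    (hS₀N : ∀ v ∈ S₀, Rat.HeightOneSpectrum.natGenerator v ∣ N₀)
    (hS : ∀ v : HeightOneSpectrum (𝓞 ℚ), v ∉ S₀ → ((p : ℕ) : 𝓞 ℚ) ∉ v.asIdeal → W.HasGoodReductionAt v)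
    (hC1 : ‖characterLValueC p (changeLevel (dvd_mul_right m (NumberField.discr K).natAbs) φ *
          changeLevel (dvd_mul_left (NumberField.discr K).natAbs m)
            (χ.ringHomComp (Int.castRingHom (ZMod p))) :
        DirichletCharacter (ZMod p) (m * (NumberField.discr K).natAbs)) ∅ 1‖ = 1)
    (hD1 : ‖characterLValueD p (changeLevel (dvd_mul_right d (NumberField.discr K).natAbs) ψ *
          changeLevel (dvd_mul_left (NumberField.discr K).natAbs d)
            (χ.ringHomComp (Int.castRingHom (ZMod p))) :
        DirichletCharacter (ZMod p) (d * (NumberField.discr K).natAbs)) ∅ 1‖ = 1)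
    (n : ℕ) (hbal : n + ∑ v ∈ S₀, delta W p v =
      ∑ v ∈ S₀, ((if φ (Rat.HeightOneSpectrum.natGenerator v : ZMod m) =
            (Rat.HeightOneSpectrum.natGenerator v : ZMod p)
          then sFactor p (Rat.HeightOneSpectrum.natGenerator v) else 0) +
        (if ψ (Rat.HeightOneSpectrum.natGenerator v : ZMod d) =
            (Rat.HeightOneSpectrum.natGenerator v : ZMod p)
          then sFactor p (Rat.HeightOneSpectrum.natGenerator v) else 0)))
    (Wd : WeierstrassCurve ℚ) [Wd.IsElliptic] [Wd.IsGloballyMinimal]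
    (C : VariableChange ℚ) (hC : C • Wd = W.quadraticTwist (NumberField.discr K : ℚ)) :
    ∃ (V' : WeierstrassCurve ℚ) (_ : V'.IsElliptic) (_ : V'.IsGloballyMinimal), IsIsogenous Wd V' ∧
      ∃ (S₀' : Finset (HeightOneSpectrum (𝓞 ℚ))) (Φ' : AddSubgroup (V'.geomTorsion (p : ℤ)))
        (m' : ℕ) (_ : NeZero m') (φ' : DirichletCharacter (ZMod p) m')
        (d' : ℕ) (_ : NeZero d') (ψ' : DirichletCharacter (ZMod p) d'),
        IsRationalLine V' p Φ' ∧ ¬ LineUnramifiedAt V' p Φ' ∧ LineEven V' p Φ' ∧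
        φ'.IsPrimitive ∧ ψ'.IsPrimitive ∧ p ∣ m' ∧ ¬ p ∣ d' ∧
        (∀ (σ : absoluteGaloisGroup ℚ), ∀ Q ∈ Φ',
          σ • Q = (φ' ((modNCyclotomicCharacter ℚ m' σ : (ZMod m')ˣ) : ZMod m')).val • Q) ∧
        (∀ (σ : absoluteGaloisGroup ℚ) (Q : V'.geomTorsion (p : ℤ)),
          σ • Q - (ψ' ((modNCyclotomicCharacter ℚ d' σ : (ZMod d')ˣ) : ZMod d')).val • Q ∈ Φ') ∧
        (∀ v ∈ S₀', ((p : ℕ) : 𝓞 ℚ) ∉ v.asIdeal) ∧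
        (∀ v : HeightOneSpectrum (𝓞 ℚ), v ∉ S₀' → ((p : ℕ) : 𝓞 ℚ) ∉ v.asIdeal →
          V'.HasGoodReductionAt v) ∧
        ‖characterLValueC p φ' ∅ 1‖ = 1 ∧ ‖characterLValueD p ψ' ∅ 1‖ = 1 ∧
        n + ∑ v ∈ S₀', delta V' p v =
          ∑ v ∈ S₀', ((if φ' (Rat.HeightOneSpectrum.natGenerator v : ZMod m') =
                (Rat.HeightOneSpectrum.natGenerator v : ZMod p)
              then sFactor p (Rat.HeightOneSpectrum.natGenerator v) else 0) +
            (if ψ' (Rat.HeightOneSpectrum.natGenerator v : ZMod d') =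
                (Rat.HeightOneSpectrum.natGenerator v : ZMod p)
              then sFactor p (Rat.HeightOneSpectrum.natGenerator v) else 0)) := by
  have hpP : p.Prime := Fact.out
  have h2 : Module.finrank ℚ K = 2 := hK.1
  have hDneg : NumberField.discr K < 0 := hK.discr_neg
  obtain ⟨hD4, hsqN⟩ := discr_emod_four_eq_one_and_squarefree_natAbs_of_odd h2 hodd
  -- `p` splits in `K`, so `p ∤ d_K`
  have hpD : ¬ (p : ℤ) ∣ NumberField.discr K :=
    Literature.SatisfiesHeegnerHypothesis.not_dvd_discr h2 hHp hpP dvd_rfl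
  -- `χ` IS part 3's Jacobi character
  obtain ⟨χ', hχ2, hχp, hχJ', hχrad⟩ := exists_quadraticChar_geomSqrt_of_emod_four (p := p) hp2 hD4 hsqN
  obtain rfl : χ = χ' := mulChar_eq_of_forall_natCast fun a ↦ by rw [hχJ, hχJ']
  -- the twist line with its characters (part 2, first shape)
  obtain ⟨Ψ₀, hΨ, hΨram, hΨeven, hprimφ, hprimψ, hpmN, hpdN, hφ0', hψ0'⟩ :=
    exists_twistLine_ramifiedEven_characters (W := W) (Wd := Wd) hp2 hDneg hpD χ hχ2 hχrad hχp hΦ hram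
      hoddL φ ψ hφ hψ hpm hpd hmD hdD hφ0 hψ0 C hC
  -- the places of `d_K` (§1)
  obtain ⟨T, hT, hST, hTD, hTp, hTS, hTcop, hTp'⟩ := exists_places_discr h2 hpP hpD hHN S₀ hS₀N
  have hTgood : ∀ v ∈ T, W.HasGoodReductionAt v := fun v hv ↦ hS v (hTS v hv) (hTp v hv)
  have hχ1 : ∀ v ∈ S₀, χ (Rat.HeightOneSpectrum.natGenerator v : ZMod (NumberField.discr K).natAbs) = 1 :=
    fun v hv ↦ chi_natCast_eq_one_of_heegner' h2 hD4 hHN χ hχJ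
      (Rat.HeightOneSpectrum.prime_natGenerator v) (hS₀N v hv)
  refine ⟨Wd, inferInstance, inferInstance, isIsogenous_self Wd, S₀ ∪ T, Ψ₀,
    m * (NumberField.discr K).natAbs, inferInstance, _, d * (NumberField.discr K).natAbs, inferInstance, _,
    hΨ, hΨram, hΨeven, hprimφ, hprimψ, hpmN, hpdN, hφ0', hψ0', ?_, ?_, hC1, hD1, ?_⟩
  · -- `p ∉ S₀ ∪ T`
    exact fun v hv ↦ (Finset.mem_union.mp hv).elim (hS₀p v) (hTp v)
  · -- `Wd` is good off `S₀ ∪ T ∪ {p}`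
    intro v hv hpv
    rw [Finset.mem_union, not_or] at hv
    have hvD : ¬ ((Rat.HeightOneSpectrum.natGenerator v : ℕ) : ℤ) ∣ NumberField.discr K :=
      fun h ↦ hv.2 ((hT v).mpr (Int.natCast_dvd.mp h))
    exact hasGoodReductionAt_of_smul_eq_quadraticTwist hD4 C hC v hvD (hS v hv.1 hpv)
  · -- the balance over `S₀ ∪ T` («c(E^K) = c(E)», part 4)
    exact (balance_union_iff φ ψ _ _ S₀ T hST
      (fun v hv ↦ delta_twist_eq_of_heegner W K p h2 hHN v (hS₀N v hv) C hC)
      (fun v hv ↦ delta_twist_eq_zero_of_dvd_discr W K p h2 v (hTD v hv) (hTgood v hv) C hC)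
      (fun v hv ↦ twistChar_natCast_of_apply_eq_one φ χ (hχ1 v hv))
      (fun v hv ↦ twistChar_natCast_of_apply_eq_one ψ χ (hχ1 v hv))
      (fun v hv ↦ twistChar_natCast_of_not_coprime φ χ (hTcop v hv))
      (fun v hv ↦ twistChar_natCast_of_not_coprime ψ χ (hTcop v hv)) hTp' n).mpr hbal

end Summit.BirchSwinnertonDyer.BirchSwinnertonDyer.Theorems.EisensteinPrimesMazurMCOnCellBTwistbackTwistDoor

end
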